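import Summits.MatrixMultiplication.MatrixMultiplication.Theorems.OutsiderSandwichTwistCapacity
import HarnessLib

/-!
# Column-disjoint sign-untwisted certificates need `B ≥ (4/3)^N` copies

Route `OutsiderSandwich` (decomposition cell `decomp-mm`, lens 4 «minimal counterexample /
extremal reduction», gen 27), support for the aside leaf `BlockOneIsMM`
(stmt-MatrixMultiplication-27147, `⟺ θ⋆ = 0`); the cut of record `closes(LaserTangency,
LaserMergeOptimal, SummitIffLaserTangency)` is untouched.  Consumes the capacity law of
`OutsiderSandwichTwistCapacity` (`|C| · rank A ≤ 6^N` for sign-untwisted pattern sets).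

## The certificate class (normal form of `OutsiderSandwichTwistSlices`)

A restriction `⟨B⟩ ⊠ C₁^{⊠N} ≥ ⟨2^N, 2^N, 2^N⟩` consists of `x`-leg maps `A_i` (copy `i`), and
vector-leg matrices wiring the blocks `(i, c) : v ↦ τ_c(A_i X) v` (`c ∈ (ℤ/2)^N`, `τ_c = ptrans c`)
to the `2^N` target columns `y_d ↦ X y_d`.  It is **column-disjoint (CD)** if every block is wired
to at most one target column (`col i c = some d`, or `none` if unused) on both vector legs; the
restriction identities then reduce to one identity per column,
`Σ_{(i,c) : col i c = d} G_{i,c} · τ_c(A_i X) · H_{i,c} = X` for all `X` (`ident`).  A used block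
`(i, c)` is **sign-untwisted (SU)** if `τ_c ∘ A_i = ε • A_i` for a scalar `ε` (e.g. `c = 0`, or
`A_i` with range in the twist-invariant = symmetric-core matrices, or in a signed isotypic piece).
The separable certificates of `OutsiderSandwichTwistGluing` (`SepCert`, linear case) are the CD
certificates with ONE block per column; the trivial certificate (`B = 2^N`, `trivial_ident`) and
every block-monogamous certificate through the symmetric core `P^{⊠N}` are CD ∧ SU
(`trivial_bound` instantiates the no-go at the trivial certificate).

## Results

* `four_pow_le_sum_finrank` — per column, the `x`-leg maps of the blocks serving it are JOINTLY
  injective (`X` is recovered), so `4^N ≤ Σ_{blocks b serving d} rank A_{i_b}`.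
* `four_pow_le_card_mul_three_pow` — **CD ∧ SU ⟹ `4^N ≤ B · 3^N`**, i.e. `B ≥ (4/3)^N`: summing
  over the `2^N` columns, disjointness turns the left side into `Σ_i |C_i| · rank A_i`
  (`C_i` = patterns of the used blocks of copy `i`), and the capacity law bounds each copy by `6^N`.
  So in this class the census value `⌈(4/3)^N⌉` of the symmetric core (I75, `N ≤ 8`) cannot be
  beaten: no CD ∧ SU certificate at the core-beating pairs `(N, B) = (3,2), (4,3), (5,4), (6,5)`
  (`no_cdsu_three_two`, …).
* `exists_twisted_block` — the extremal reading: **a column-disjoint certificate with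
  `B · 3^N < 4^N` copies uses a GENUINELY TWISTED block** (`τ_c ∘ A_i ≠ ε • A_i` for every `ε`).
  Together with `two_pow_le_of_sepCert` this locates any sub-core-rate witness: it mixes blocks
  (g26) and, if column-disjoint, at least one of them is twisted — else it shares blocks between
  columns (the direct-sum packing regime).  Not decided here (instrument asks): whether a CD
  certificate with twisted blocks, or a non-CD SU certificate, beats `(4/3)^N`.

Relation to `symHelpedDeg_floor` (gen 25, `4^N ≤ B · 3^N` for certificates THROUGH the core
`P^{⊠N}` in ANY wiring, by flattening rank): neither class contains the other — here signs
`ε = -1` and partial pattern sets are allowed (such copies do not factor through `P^{⊠N}`), there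
the wiring is unrestricted.  No definition, no instance, no Literature notion is introduced.

## References

* M. Bläser, *Fast Matrix Multiplication*, Theory of Computing Graduate Surveys 5 (2013), §5,
  Def. 7.2 (restrictions; the trivial and direct-sum certificates). [Blaser2013]
* D. Coppersmith, S. Winograd, *Matrix multiplication via arithmetic progressions*,
  J. Symb. Comp. 9 (1990), §7 (coupled blocks). [CoppersmithWinograd1990]
* J.-P. Serre, *Linear Representations of Finite Groups*, GTM 42 (1977), §2.3, Ex. 2.6
  (Burnside, inside the capacity law). [Serre1977]
-/

noncomputable section

open scoped BigOperators Matrix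

set_option linter.dupNamespace false
set_option autoImplicit false

namespace Summit.MatrixMultiplication.MatrixMultiplication.Theorems.OutsiderSandwichColumnDisjoint

open Summit.MatrixMultiplication.MatrixMultiplication.Theorems.OutsiderSandwichTwistGluing
  Summit.MatrixMultiplication.MatrixMultiplication.Theorems.OutsiderSandwichTwistCapacity

universe u v

variable {N : ℕ} {K : Type u} [Field K] {ι : Type v} [Fintype ι]

/-- `dim (2^N × 2^N matrices) = 4^N`. -/
theorem finrank_matrix_Idx : Module.finrank K (Matrix (Idx N) (Idx N) K) = 4 ^ N := by
  rw [Module.finrank_matrix, Module.finrank_self, mul_one, card_Idx, ← mul_pow]; norm_num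

/-! ## 1. Per column: the serving blocks' `x`-leg maps are jointly injective -/

/-- **Per-column rank count.**  If the blocks `b = (i, c)` of the finite set `T` reproduce `X` on
one target column (`Σ_{b ∈ T} G_b · τ_{c}(A_i X) · H_b = X` for all `X`), then
`X ↦ (A_i X)_{(i,c) ∈ T}` is injective, so `4^N ≤ Σ_{b ∈ T} rank A_{i_b}`. -/
theorem four_pow_le_sum_finrank
    (A : ι → Matrix (Idx N) (Idx N) K →ₗ[K] Matrix (Idx N) (Idx N) K)
    (G H : ι → Idx N → Matrix (Idx N) (Idx N) K) (T : Finset (ι × Idx N))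
    (ident : ∀ X, ∑ b ∈ T, G b.1 b.2 * ptrans b.2 (A b.1 X) * H b.1 b.2 = X) :
    4 ^ N ≤ ∑ b ∈ T, Module.finrank K (LinearMap.range (A b.1)) := by
  classical
  let φ : Matrix (Idx N) (Idx N) K →ₗ[K] ((b : T) → LinearMap.range (A b.1.1)) :=
    LinearMap.pi fun b => (A b.1.1).rangeRestrict
  have hφ : Function.Injective φ := by
    intro X X' h
    have hA : ∀ b ∈ T, A b.1 X = A b.1 X' := fun b hb => by
      have h1 := congrFun h ⟨b, hb⟩
      simp only [φ, LinearMap.pi_apply] at h1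
      simpa only [LinearMap.codRestrict_apply] using congrArg Subtype.val h1
    calc X = ∑ b ∈ T, G b.1 b.2 * ptrans b.2 (A b.1 X) * H b.1 b.2 := (ident X).symm
      _ = ∑ b ∈ T, G b.1 b.2 * ptrans b.2 (A b.1 X') * H b.1 b.2 :=
          Finset.sum_congr rfl fun b hb => by rw [hA b hb]
      _ = X' := ident X'
  calc 4 ^ N = Module.finrank K (Matrix (Idx N) (Idx N) K) := finrank_matrix_Idx.symm
    _ ≤ Module.finrank K ((b : T) → LinearMap.range (A b.1.1)) :=
        LinearMap.finrank_le_finrank_of_injective hφ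
    _ = ∑ b : T, Module.finrank K (LinearMap.range (A b.1.1)) := Module.finrank_pi_fintype K
    _ = ∑ b ∈ T, Module.finrank K (LinearMap.range (A b.1)) :=
        Finset.sum_coe_sort T fun b => Module.finrank K (LinearMap.range (A b.1))

/-! ## 2. Column-disjoint sign-untwisted certificates: `4^N ≤ B · 3^N` -/

/-- **CD ∧ SU ⟹ `4^N ≤ B · 3^N`.**  A column-disjoint certificate (`x`-leg maps `A i`, block
`(i, c)` wired to column `col i c`, vector-leg matrices `G i c`, `H i c`, column identities
`ident`) all of whose USED blocks are sign-untwisted (`hSU`) has at least `(4/3)^N` copies. -/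
theorem four_pow_le_card_mul_three_pow
    (A : ι → Matrix (Idx N) (Idx N) K →ₗ[K] Matrix (Idx N) (Idx N) K)
    (col : ι → Idx N → Option (Idx N)) (G H : ι → Idx N → Matrix (Idx N) (Idx N) K)
    (ident : ∀ (d : Idx N) (X : Matrix (Idx N) (Idx N) K),
      ∑ b ∈ Finset.univ.filter (fun b : ι × Idx N => col b.1 b.2 = some d),
        G b.1 b.2 * ptrans b.2 (A b.1 X) * H b.1 b.2 = X)
    (hSU : ∀ i c, col i c ≠ none → ∃ ε : K, ∀ X, ptrans c (A i X) = ε • A i X) :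
    4 ^ N ≤ Fintype.card ι * 3 ^ N := by
  classical
  -- rank of copy `i` and the pattern set of its used blocks
  let rk : ι → ℕ := fun i => Module.finrank K (LinearMap.range (A i))
  let C : ι → Finset (Idx N) := fun i => Finset.univ.filter fun c => col i c ≠ none
  -- (1) per column
  have hcol : ∀ d : Idx N, 4 ^ N ≤
      ∑ b ∈ Finset.univ.filter (fun b : ι × Idx N => col b.1 b.2 = some d), rk b.1 :=
    fun d => four_pow_le_sum_finrank A G H _ (ident d)
  -- (2) summing over columns: disjointness of the fibres of `col`
  have hfib : ∀ b : ι × Idx N,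
      ∑ d : Idx N, (if col b.1 b.2 = some d then rk b.1 else 0) =
        if col b.1 b.2 ≠ none then rk b.1 else 0 := by
    intro b
    cases hb : col b.1 b.2 with
    | none => simp
    | some d₀ =>
        simp only [Option.some.injEq, ne_eq, reduceCtorEq, not_false_eq_true, if_true]
        rw [Finset.sum_ite_eq Finset.univ d₀ (fun _ => rk b.1), if_pos (Finset.mem_univ _)]
  have hsum : ∑ d : Idx N,
      ∑ b ∈ Finset.univ.filter (fun b : ι × Idx N => col b.1 b.2 = some d), rk b.1 =
        ∑ i, (C i).card * rk i := by
    calc ∑ d : Idx N, ∑ b ∈ Finset.univ.filter (fun b : ι × Idx N => col b.1 b.2 = some d), rk b.1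
        = ∑ d : Idx N, ∑ b : ι × Idx N, (if col b.1 b.2 = some d then rk b.1 else 0) :=
          Finset.sum_congr rfl fun d _ => Finset.sum_filter _ _
      _ = ∑ b : ι × Idx N, ∑ d : Idx N, (if col b.1 b.2 = some d then rk b.1 else 0) :=
          Finset.sum_comm
      _ = ∑ b : ι × Idx N, (if col b.1 b.2 ≠ none then rk b.1 else 0) :=
          Finset.sum_congr rfl fun b _ => hfib b
      _ = ∑ i, ∑ c : Idx N, (if col i c ≠ none then rk i else 0) :=
          Fintype.sum_prod_type _
      _ = ∑ i, (C i).card * rk i := Finset.sum_congr rfl fun i _ => by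
          rw [← Finset.sum_filter, Finset.sum_const, smul_eq_mul]
  -- (3) capacity law per copy
  have hcap : ∀ i, (C i).card * rk i ≤ 6 ^ N := fun i =>
    card_mul_finrank_range_le (A i) (C i) fun c hc => hSU i c (Finset.mem_filter.1 hc).2
  -- assemble: `2^N · 4^N ≤ Σ_i |C_i| · rk_i ≤ card ι · 6^N = 2^N · (card ι · 3^N)`
  have h8 : 2 ^ N * 4 ^ N ≤ Fintype.card ι * 6 ^ N := by
    calc 2 ^ N * 4 ^ N = ∑ _d : Idx N, 4 ^ N := by rw [Finset.sum_const, Finset.card_univ,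
          card_Idx, smul_eq_mul]
      _ ≤ ∑ d : Idx N,
            ∑ b ∈ Finset.univ.filter (fun b : ι × Idx N => col b.1 b.2 = some d), rk b.1 :=
          Finset.sum_le_sum fun d _ => hcol d
      _ = ∑ i, (C i).card * rk i := hsum
      _ ≤ ∑ _i : ι, 6 ^ N := Finset.sum_le_sum fun i _ => hcap i
      _ = Fintype.card ι * 6 ^ N := by rw [Finset.sum_const, Finset.card_univ, smul_eq_mul]
  rw [show (6 : ℕ) ^ N = 2 ^ N * 3 ^ N by rw [← mul_pow]; norm_num, Nat.mul_left_comm] at h8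
  exact Nat.le_of_mul_le_mul_left h8 (pow_pos two_pos N)

/-- **Extremal reading: a column-disjoint certificate beating `(4/3)^N` uses a twisted block.**
If `card ι · 3^N < 4^N`, some USED block `(i, c)` has `τ_c ∘ A_i ≠ ε • A_i` for every scalar
`ε` — a genuinely twisted orientation of the copy's `x`-leg is load-bearing. -/
theorem exists_twisted_block
    (A : ι → Matrix (Idx N) (Idx N) K →ₗ[K] Matrix (Idx N) (Idx N) K)
    (col : ι → Idx N → Option (Idx N)) (G H : ι → Idx N → Matrix (Idx N) (Idx N) K)
    (ident : ∀ (d : Idx N) (X : Matrix (Idx N) (Idx N) K),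
      ∑ b ∈ Finset.univ.filter (fun b : ι × Idx N => col b.1 b.2 = some d),
        G b.1 b.2 * ptrans b.2 (A b.1 X) * H b.1 b.2 = X)
    (hlt : Fintype.card ι * 3 ^ N < 4 ^ N) :
    ∃ i c, col i c ≠ none ∧ ∀ ε : K, ∃ X, ptrans c (A i X) ≠ ε • A i X := by
  by_contra h
  simp only [not_exists, not_and, not_forall, ne_eq, not_not] at h
  exact absurd (four_pow_le_card_mul_three_pow A col G H ident fun i c hic => h i c hic)
    (not_le.2 hlt)

/-! ## 3. The table at the core-beating pairs, and the trivial certificate -/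

/-- No CD ∧ SU certificate at `(N, B) = (3, 2)` (`2 · 27 < 64`). -/
theorem no_cdsu_three_two {ι : Type v} [Fintype ι] (hι : Fintype.card ι = 2)
    (A : ι → Matrix (Idx 3) (Idx 3) K →ₗ[K] Matrix (Idx 3) (Idx 3) K)
    (col : ι → Idx 3 → Option (Idx 3)) (G H : ι → Idx 3 → Matrix (Idx 3) (Idx 3) K)
    (ident : ∀ (d : Idx 3) (X : Matrix (Idx 3) (Idx 3) K),
      ∑ b ∈ Finset.univ.filter (fun b : ι × Idx 3 => col b.1 b.2 = some d),
        G b.1 b.2 * ptrans b.2 (A b.1 X) * H b.1 b.2 = X) :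
    ∃ i c, col i c ≠ none ∧ ∀ ε : K, ∃ X, ptrans c (A i X) ≠ ε • A i X :=
  exists_twisted_block A col G H ident (by rw [hι]; norm_num)

/-- No CD ∧ SU certificate at `(N, B) = (4, 3)`, `(5, 4)`, `(6, 5)`, `(7, 7)`, `(8, 9)`: the
numerics `B · 3^N < 4^N` (so a CD certificate there has a twisted used block, by
`exists_twisted_block`); `⌈(4/3)^N⌉ = 2, 2, 3, 4, 5, 6, 8, 10` for `N = 1, …, 8` is the census
value of the symmetric core (I75). -/
theorem core_beating_numerics :
    3 * 3 ^ 4 < 4 ^ 4 ∧ 4 * 3 ^ 5 < 4 ^ 5 ∧ 5 * 3 ^ 6 < 4 ^ 6 ∧ 7 * 3 ^ 7 < 4 ^ 7 ∧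
      9 * 3 ^ 8 < 4 ^ 8 ∧ 4 ^ 8 ≤ 10 * 3 ^ 8 := by
  norm_num

/-- **The trivial certificate is CD ∧ SU** (`B = 2^N` copies indexed by the columns, copy `d`
serves column `d` through its untwisted block `c = 0` with `A_d = id`, `G = H = 1`): the class is
populated, and for it `four_pow_le_card_mul_three_pow` reads `4^N ≤ 2^N · 3^N`. -/
theorem trivial_ident (d : Idx N) (X : Matrix (Idx N) (Idx N) K) :
    ∑ b ∈ Finset.univ.filter
        (fun b : Idx N × Idx N => (if b.2 = 0 then some b.1 else none) = some d),
      (1 : Matrix (Idx N) (Idx N) K) * ptrans b.2 (LinearMap.id (R := K) X) * 1 = X := by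
  classical
  rw [Finset.sum_eq_single_of_mem (d, 0)]
  · rw [LinearMap.id_apply, ptrans_zero, Matrix.one_mul, Matrix.mul_one]
  · simp
  · rintro ⟨i, c⟩ hb hne
    simp only [Finset.mem_filter, Finset.mem_univ, true_and] at hb
    by_cases hc : c = 0
    · rw [if_pos hc, Option.some.injEq] at hb
      exact absurd (Prod.ext hb hc) hne
    · rw [if_neg hc] at hb
      exact absurd hb (by simp)

/-- The trivial certificate's used blocks (`c = 0`) are sign-untwisted with `ε = 1`. -/
theorem trivial_signUntwisted (i c : Idx N)
    (h : (if c = 0 then some i else none : Option (Idx N)) ≠ none) :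
    ∃ ε : K, ∀ X : Matrix (Idx N) (Idx N) K,
      ptrans c (LinearMap.id (R := K) X) = ε • LinearMap.id (R := K) X := by
  by_cases hc : c = 0
  · exact ⟨1, fun X => by rw [hc, LinearMap.id_apply, ptrans_zero, one_smul]⟩
  · exact absurd (by rw [if_neg hc]) h

/-- Instantiating the no-go at the trivial certificate (over `ℚ`): `4^N ≤ 2^N · 3^N` — the
hypotheses of `four_pow_le_card_mul_three_pow` are jointly satisfiable (sanity anchor). -/
theorem trivial_bound : 4 ^ N ≤ Fintype.card (Idx N) * 3 ^ N :=
  four_pow_le_card_mul_three_pow (K := ℚ) (fun _ => LinearMap.id)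
    (fun i c => if c = 0 then some i else none) (fun _ _ => 1) (fun _ _ => 1)
    (fun d X => trivial_ident d X) (fun i c h => trivial_signUntwisted i c h)

end Summit.MatrixMultiplication.MatrixMultiplication.Theorems.OutsiderSandwichColumnDisjoint
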